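import Summits.QuantumFields.BalabanUV.Beta.FP.PeriodisedFormIndexWard
import Summits.QuantumFields.BalabanUV.Beta.D1BFx.ColourLift

/-!
# `BalabanUV.Beta.FP.PeriodisedFormIndexWardDoubled` — road «FP» for binder row D1, ROUTE T: **THE PERIODISED WILSON FORM-INSERTION FAMILY IS AN ANTISYMMETRIC MATRIX,
# AND ITS INDEX-SLOT LAW IS THE `k1` LETTER IN COLOUR-DOUBLED FORM**
# (the premise of the OWNER's F-FP-18-2 (1), KERNEL-CHECKED at the torus call's types for the level-0 Wilson family): for every index bond `(κ, u)` and every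
# box `M`, `(perF M (dper M (wilsonA d κ u))∘(fields, fields))ᵀ = −(same)`; hence `(H₁^{(w)})ᵀ = −H₁^{(w)}` for every direction `w` (the DISPLAYED
# antisymmetry hypothesis of leaf-02 g19's `WardPairRankObstruction(Torus)` for this family); and (§2, the OWNER's
# F-FP-18-3 «COLOUR DOUBLING» l.41136: «leaf-05's commutator law IS `k1` in doubled form») for ANY antisymmetric colour factor `J` (`Jᵀ = −J`, any index type)
# the similarity letter of `PeriodisedFormIndexWard.torus_k1_sim_letter` doubles to the CONGRUENCE letter `k1` of `NestedStepLawTorusTransported` on `c × ν`: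
# `(J ⊗ₖ X)ᵀ·(1 ⊗ₖ H₀) + J ⊗ₖ (w•H₁^{(h)}) + (1 ⊗ₖ H₀)·(J ⊗ₖ X) = J ⊗ₖ (w•H₁^{(h+Dλ)})`, `X = (w/2)•E_λ` DIAGONAL, the doubled generator `J ⊗ₖ X` ANTISYMMETRIC

HONEST DEPENDENCY (page 1, mandatory): continuum YM on T⁴ ⇐ BetaPertH ∧ nine spine estimates (0/9 proved); BetaPertH ⇐ (D1) ∧ (D4) ∧ CAP+tail;
G-an2-4 gates asym, D1 and NE2/3/4.  HONEST FRAMING (cell contract, verbatim): «discharging `BetaPertH` makes Bałaban's UV stability UNCONDITIONAL —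
a real constructive-QFT result; it is NOT the continuum limit and NOT the Clay problem.»  ABSOLUTE RULE (cell charter, verbatim): «No internally-minted
statement may enter as a cited fact. Every hypothesis is either kernel-proved in this package or a verbatim quotation of a PUBLISHED theorem with page
reference. The manuscript(s) under audit are NOT citable for their own disputed steps — they are the thing under adjudication; programme-internal
(2001/route/tribunal) claims are never citable.»  THIS MODULE is [folklore] re-indexing over OUR typed objects BY NAME: lit-balaban's `StepJetData.wilsonA_antisymm`
(«`wilsonA` is the coefficient of a commutator»), gan24-p3's `KernelPeriodisationFib.perF_transpose ∕ trF ∕ perZ_apply` and `KernelPeriodisationFibLoc.dper_translate`,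
this lineage's `PeriodisedFormIndexWard.torus_k1_sim_letter`, road «BF-x»'s `D1BFx.ColourLift` (d1-p2; K-TA4C) BY NAME; no `def`, no `def … : Prop`, nothing cited, 0 sorry; 0 estimates; 0∕4 row-D1 binders; it does NOT say which
table the dictionary instantiates as `H₁` at the record (an2, Q-FP-18-2) — it prices the level-0 periodised WILSON family only; NOT (T-ID), NOT SDF, NOT D1, NOT
BetaPertH, NOT continuum, NOT Clay.  «not in print; our bookkeeping».

CONTENT.  §0 **`lifted_congr_word_of_sim_word`** (road «BF-x»'s `D1BFx.ColourLift` BY NAME — `kronecker_transpose'`, `neg_kronecker`, `kronecker_neg`; for `cᵀ = −c`,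
`Xᵀ = X`: `−X·H₀ + H₁ + H₀·X = H′₁ → (c ⊗ₖ X)ᵀ·(1 ⊗ₖ H₀) + c ⊗ₖ H₁ + (1 ⊗ₖ H₀)·(c ⊗ₖ X) = c ⊗ₖ H′₁`; the lifted bordered jet's ANTISYMMETRIC border placement is
d1-p2's `ColourLift.kkt_kronecker₂ (s := −1)` — cited, not restated).  §1 `trF_dper_wilsonA` (`trF (dper M (wilsonA d κ u)) = −dper M (wilsonA d κ u)`), `perF_dper_wilsonA_transpose`, **`torus_H1_family_transpose`**
(`(H₁^{b})ᵀ = −H₁^{b}` at the call's field index), **`torus_H1_transpose`** (`(H₁^{(w)})ᵀ = −H₁^{(w)}`).  (The sum of the two-sided rows `a1 ∧ a1t`, `2 • (H₀·W₁) = 𝔔₀ᵀ·(Y₁ + Y′₁)`, is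
leaf-02 g19's generic `WardPairRankObstruction.wardPair_sum` — §1 supplies its displayed antisymmetry hypothesis for the Wilson family; not restated here.)  §2 **`torus_k1_doubled`**: the level-0 form-block letter `k1` HOLDS in `J`-doubled form
(`torus_k1_sim_letter` + §0), for every weight `w`, direction `h`, gauge function `λ`, antisymmetric colour factor `J` (e.g. `ColourLift.cgen`).
Provenance: D1 formalisation swarm LEAF PROVER 05, unit b2b-balaban-beta-d1-formalise-leaf-05 gen 27, 2026-08-22.  No existing file touched.
-/

noncomputable section

open scoped BigOperators

namespace Summit.QuantumFields.BalabanUV.Beta.FP.PeriodisedFormIndexWardDoubled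

open Finset Matrix
open Literature.MathematicalPhysics.QuantumFieldTheory.Balaban1983to89
open Literature.MathematicalPhysics.QuantumFieldTheory.Balaban1983to89.Beta
open B5Prop11Plancherel (fine)
open B6Lemma24Torus (pbox)
open ExpKernelCalculus (MKer)
open StepJetData (wilsonA wilsonA_antisymm)
open AffineAveraging (Site box toSite)
open OneStepResolventKernel (Fib)
open Summit.QuantumFields.BalabanUV.Beta.BorderedHessian (bhKStepAt)
open Summit.QuantumFields.BalabanUV.Beta.FP.KernelPeriodisationFib (Idx perF perF_apply perZ perZ_apply trF perF_transpose)
open Summit.QuantumFields.BalabanUV.Beta.FP.KernelPeriodisationFibLoc (dper dper_apply dper_translate)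
open Summit.QuantumFields.BalabanUV.Beta.FP.TorusGaugeCovariance (tgrad)
open Summit.QuantumFields.BalabanUV.Beta.FP.PeriodisedFormIndexWard (torus_k1_sim_letter)
open Literature.MathematicalPhysics.QuantumFieldTheory.Balaban1983to89.Beta.Composition (kkt)
open scoped Kronecker
open Summit.QuantumFields.BalabanUV.Beta.D1BFx.ColourLift (kronecker_transpose' neg_kronecker kronecker_neg)

variable {d : ℕ}

/-! ## §0 A similarity word with a symmetric generator LIFTS to a congruence word with an antisymmetric one (road BF-x's `ColourLift` BY NAME) -/

section Doubling

/-- [folklore] **COLOUR LIFT OF A FIRST-ORDER WORD** (the OWNER's F-FP-18-3 ∕ W-FP-18-8: road «BF-x»'s antisymmetric colour lift `D1BFx.ColourLift`, adopted BY NAME):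
for an antisymmetric colour factor `c` (`cᵀ = −c`; e.g. `ColourLift.cgen`, `cgen_transpose`) and a symmetric generator `X`, the SIMILARITY word
`−X·H₀ + H₁ + H₀·X = H′₁` on `ν` gives the CONGRUENCE word `(c ⊗ₖ X)ᵀ·(1 ⊗ₖ H₀) + c ⊗ₖ H₁ + (1 ⊗ₖ H₀)·(c ⊗ₖ X) = c ⊗ₖ H′₁` on `l × ν` — the lifted generator
`c ⊗ₖ X` is antisymmetric, so its transpose supplies the sign the stripped diagonal generator lacks (`ColourLift.kronecker_transpose'`, `neg_kronecker`,
`kronecker_neg`, Mathlib `mul_kronecker_mul`).  (The companion fact «the lifted bordered jet `kkt (c ⊗ₖ K) (c ⊗ₖ Q)` is the lift of `[[K, −Qᵀ],[Q, 0]]`» is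
d1-p2's `ColourLift.kkt_kronecker₂ (s := −1)`, not restated here.) -/
theorem lifted_congr_word_of_sim_word {ν l : Type*} [Fintype ν] [Fintype l] [DecidableEq l] (c : Matrix l l ℝ) (hc : cᵀ = -c)
    (H₀ H₁ H'₁ X : Matrix ν ν ℝ) (hX : Xᵀ = X) (h : -X * H₀ + H₁ + H₀ * X = H'₁) :
    (c ⊗ₖ X)ᵀ * ((1 : Matrix l l ℝ) ⊗ₖ H₀) + c ⊗ₖ H₁ + ((1 : Matrix l l ℝ) ⊗ₖ H₀) * (c ⊗ₖ X) = c ⊗ₖ H'₁ := by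
  rw [kronecker_transpose', hc, hX, neg_kronecker, Matrix.neg_mul, ← Matrix.mul_kronecker_mul, ← Matrix.mul_kronecker_mul, Matrix.mul_one,
    Matrix.one_mul, ← h, Matrix.neg_mul, Matrix.kronecker_add, Matrix.kronecker_add, kronecker_neg]

end Doubling

/-! ## §1 Antisymmetry of the periodised Wilson family -/

section Antisymm

variable (M : Fin (d + 1) → ℕ)

/-- [folklore] the lattice-summed Wilson table is antisymmetric: `trF (dper M (wilsonA d κ u)) = −dper M (wilsonA d κ u)`. -/
theorem trF_dper_wilsonA (κ : Fin (d + 1)) (u : Site (d + 1)) : trF (dper M (wilsonA d κ u)) = -dper M (wilsonA d κ u) := by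
  funext x y a b
  simp only [trF, Pi.neg_apply, dper_apply, ← tsum_neg]
  exact tsum_congr fun m => wilsonA_antisymm κ u _ _ a b

/-- [folklore] hence its periodisation is an antisymmetric matrix: `(perF M (dper M (wilsonA d κ u)))ᵀ = −perF M (dper M (wilsonA d κ u))`. -/
theorem perF_dper_wilsonA_transpose (κ : Fin (d + 1)) (u : Site (d + 1)) :
    (perF M (dper M (wilsonA d κ u)))ᵀ = -perF M (dper M (wilsonA d κ u)) := by
  rw [← perF_transpose M (fun m x y a b => dper_translate M (wilsonA d κ u) m x y a b), trF_dper_wilsonA]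
  ext p q
  simp only [perF_apply, Matrix.neg_apply, perZ_apply, Pi.neg_apply, tsum_neg]

/-- [folklore] **EACH MEMBER OF THE FORM-INSERTION FAMILY IS ANTISYMMETRIC** at the field index of the torus call: `(H₁^{b})ᵀ = −H₁^{b}`,
`H₁^{b} := perF M (dper M (wilsonA d b.2 b.1))∘(fields, fields)`. -/
theorem torus_H1_family_transpose (b : ↥(pbox M) × Fin (d + 1)) :
    ((perF M (dper M (wilsonA d b.2 (b.1 : Site (d + 1))))).submatrix
        (fun b : ↥(pbox M) × Fin (d + 1) => ((b.1, Sum.inl b.2) : Idx M (Fib d)))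
        (fun b : ↥(pbox M) × Fin (d + 1) => ((b.1, Sum.inl b.2) : Idx M (Fib d))))ᵀ
      = -(perF M (dper M (wilsonA d b.2 (b.1 : Site (d + 1))))).submatrix
        (fun b : ↥(pbox M) × Fin (d + 1) => ((b.1, Sum.inl b.2) : Idx M (Fib d)))
        (fun b : ↥(pbox M) × Fin (d + 1) => ((b.1, Sum.inl b.2) : Idx M (Fib d))) := by
  rw [Matrix.transpose_submatrix, perF_dper_wilsonA_transpose]
  rfl

/-- [folklore] **THE FORM JET ALONG ANY DIRECTION IS ANTISYMMETRIC**: `(H₁^{(w)})ᵀ = −H₁^{(w)}`, `H₁^{(w)} := Σ_b w b • H₁^{b}`. -/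
theorem torus_H1_transpose (w : ↥(pbox M) × Fin (d + 1) → ℝ) :
    (∑ b : ↥(pbox M) × Fin (d + 1), w b •
        (perF M (dper M (wilsonA d b.2 (b.1 : Site (d + 1))))).submatrix
          (fun b : ↥(pbox M) × Fin (d + 1) => ((b.1, Sum.inl b.2) : Idx M (Fib d)))
          (fun b : ↥(pbox M) × Fin (d + 1) => ((b.1, Sum.inl b.2) : Idx M (Fib d))))ᵀ
      = -∑ b : ↥(pbox M) × Fin (d + 1), w b •
        (perF M (dper M (wilsonA d b.2 (b.1 : Site (d + 1))))).submatrix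
          (fun b : ↥(pbox M) × Fin (d + 1) => ((b.1, Sum.inl b.2) : Idx M (Fib d)))
          (fun b : ↥(pbox M) × Fin (d + 1) => ((b.1, Sum.inl b.2) : Idx M (Fib d))) := by
  rw [Matrix.transpose_sum, ← Finset.sum_neg_distrib]
  exact Finset.sum_congr rfl fun b _ => by rw [Matrix.transpose_smul, torus_H1_family_transpose, smul_neg]

end Antisymm

/-! ## §2 The level-0 form-block letter `k1` in COLOUR-DOUBLED form -/

section Doubled

variable (M' : Fin (d + 1) → ℕ) [∀ μ, NeZero (M' μ)] {Lc : ℕ} [NeZero Lc] {r : Fin (d + 1) → ℕ}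

/-- [folklore] **`k1` HOLDS IN DOUBLED FORM AT LEVEL 0** (the OWNER's F-FP-18-3 «leaf-05's commutator law IS `k1` in doubled form»): for ANY antisymmetric colour
factor `J : Matrix c c ℝ`, any weight `w`, direction `h` and torus gauge function `λ`, with the DIAGONAL stripped generator `X := (w/2) • E_λ` and the doubled
objects `1 ⊗ₖ H₀` (form block), `J ⊗ₖ (w • H₁^{(h)})` (form jet), `J ⊗ₖ X` (generator — ANTISYMMETRIC):
`(J ⊗ₖ X)ᵀ * (1 ⊗ₖ H₀) + J ⊗ₖ (w • H₁^{(h)}) + (1 ⊗ₖ H₀) * (J ⊗ₖ X) = J ⊗ₖ (w • H₁^{(h + Dλ)})` — the `k1` binder shape of `NestedStepLawTorusTransported` on `c × ν`. -/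
theorem torus_k1_doubled {c : Type*} [Fintype c] [DecidableEq c] (J : Matrix c c ℝ) (hJ : Jᵀ = -J)
    (w : ℝ) (h : ↥(pbox (fine Lc M')) × Fin (d + 1) → ℝ) (lam : ↥(pbox (fine Lc M')) → ℝ)
    {H₀ : Matrix (↥(pbox (fine Lc M')) × Fin (d + 1)) (↥(pbox (fine Lc M')) × Fin (d + 1)) ℝ}
    (hH₀ : H₀ = (perF (fine Lc M') (bhKStepAt d (toSite r) Lc 0)).submatrix
        (fun b : ↥(pbox (fine Lc M')) × Fin (d + 1) => ((b.1, Sum.inl b.2) : Idx (fine Lc M') (Fib d)))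
        (fun b : ↥(pbox (fine Lc M')) × Fin (d + 1) => ((b.1, Sum.inl b.2) : Idx (fine Lc M') (Fib d))))
    {X : Matrix (↥(pbox (fine Lc M')) × Fin (d + 1)) (↥(pbox (fine Lc M')) × Fin (d + 1)) ℝ}
    (hX : X = (w / 2) • Matrix.diagonal (fun b : ↥(pbox (fine Lc M')) × Fin (d + 1) => lam b.1)) :
    (J ⊗ₖ X)ᵀ * ((1 : Matrix c c ℝ) ⊗ₖ H₀)
        + J ⊗ₖ (w • ∑ b : ↥(pbox (fine Lc M')) × Fin (d + 1), h b •
            (perF (fine Lc M') (dper (fine Lc M') (wilsonA d b.2 (b.1 : Site (d + 1))))).submatrix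
              (fun b : ↥(pbox (fine Lc M')) × Fin (d + 1) => ((b.1, Sum.inl b.2) : Idx (fine Lc M') (Fib d)))
              (fun b : ↥(pbox (fine Lc M')) × Fin (d + 1) => ((b.1, Sum.inl b.2) : Idx (fine Lc M') (Fib d))))
        + ((1 : Matrix c c ℝ) ⊗ₖ H₀) * (J ⊗ₖ X)
      = J ⊗ₖ (w • ∑ b : ↥(pbox (fine Lc M')) × Fin (d + 1), (h b + ∑ s : ↥(pbox (fine Lc M')), tgrad (fine Lc M') (b.1, Sum.inl b.2) s * lam s) •
          (perF (fine Lc M') (dper (fine Lc M') (wilsonA d b.2 (b.1 : Site (d + 1))))).submatrix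
            (fun b : ↥(pbox (fine Lc M')) × Fin (d + 1) => ((b.1, Sum.inl b.2) : Idx (fine Lc M') (Fib d)))
            (fun b : ↥(pbox (fine Lc M')) × Fin (d + 1) => ((b.1, Sum.inl b.2) : Idx (fine Lc M') (Fib d)))) := by
  have hXt : Xᵀ = X := by rw [hX, Matrix.transpose_smul, Matrix.diagonal_transpose]
  exact lifted_congr_word_of_sim_word J hJ H₀ _ _ X hXt (torus_k1_sim_letter M' w h lam hH₀ hX)

end Doubled

end Summit.QuantumFields.BalabanUV.Beta.FP.PeriodisedFormIndexWardDoubled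

end
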